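import Mathlib

/-!
# KernelChannel — the ring identities behind KERNEL CHANNEL and the AS-degenerate locus (solo-blind s138)

Solo-blind programme, `work/s138/regime.md` §3 and §5; claims SB-C1077, SB-C1078, SB-C1080.

Informal setting (nothing geometric is formalised here).  In the char-5 satellite analysis of
the wild tangent hyperplane sections of `X₁₀ = {Σ xᵢ⁶ + 10 ∏ xᵢ = 0}` at its 88 type-11
vertices, the K-antisymmetric first-block digit is `d_K = (d₀, d₁, d₂)` with `d₀ + d₁ + d₂ = 0`,
the Artin–Schreier matrix is `Ē₁(d_K) = [[2d₁+3d₂, 3d₁+d₂],[d₁+3d₂, 3d₁+2d₂]]` (in the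
coordinates `d_K = d₁(1,0,-1) + d₂(0,1,-1)`), the leading satellite functional is
`ℓ̄(u) = Σ dᵢ² uᵢ` and the universal quadratic slice is (a unit multiple of) `Q(u) = Σ dᵢ uᵢ²`,
both on `K = {u : Σ uᵢ = 0}`.

This file records, as identities over an arbitrary commutative ring:
* `det_E1` : `det Ē₁ = 3 (d₁² + d₁ d₂ + d₂²)` — so `Ē₁` degenerates exactly on the norm-zero
  cone of `K`, i.e. on the two `ℤ/3`-eigenlines `d_K ∝ (1, ω, ω²)`;
* for `d_K = (1, δ, -1-δ)` the vector `kcVec δ = (-2δ-1, δ²+2δ, 1-δ²)` lies in `K`, spans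
  `ker ℓ̄ ∩ K` (`kcVec_in_K`, `kcVec_in_ker`), and `Q(kcVec δ) = 3 δ (δ+1) (δ²+δ+1)` (`Q_kcVec`);
* consequences over a field with `3 ≠ 0` (`Q_kcVec_eq_zero_iff`) and over `ZMod 5`
  (`normK_ne_zero_zmod5` : the AS-degenerate locus has no `𝔽₅`-rational point).
-/

namespace Summit.HodgeConjecture.HodgeConjecture.Theorems

/-- Determinant of the Artin–Schreier matrix `Ē₁(d_K)` in the coordinates `(d₁, d₂)`:
`det [[2d₁+3d₂, 3d₁+d₂],[d₁+3d₂, 3d₁+2d₂]] = 3 (d₁² + d₁d₂ + d₂²)`. -/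
theorem det_E1 {R : Type*} [CommRing R] (d₁ d₂ : R) :
    (2*d₁ + 3*d₂) * (3*d₁ + 2*d₂) - (3*d₁ + d₂) * (d₁ + 3*d₂) = 3 * (d₁^2 + d₁*d₂ + d₂^2) := by
  ring

/-- First component of the kernel vector of `ℓ̄` for `d_K = (1, δ, -1-δ)`. -/
def kcVec₀ {R : Type*} [CommRing R] (δ : R) : R := -2*δ - 1
/-- Second component of the kernel vector. -/
def kcVec₁ {R : Type*} [CommRing R] (δ : R) : R := δ^2 + 2*δ
/-- Third component of the kernel vector. -/
def kcVec₂ {R : Type*} [CommRing R] (δ : R) : R := 1 - δ^2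

/-- The kernel vector lies in `K = {Σ uᵢ = 0}`. -/
theorem kcVec_in_K {R : Type*} [CommRing R] (δ : R) :
    kcVec₀ δ + kcVec₁ δ + kcVec₂ δ = 0 := by
  unfold kcVec₀ kcVec₁ kcVec₂; ring

/-- The kernel vector is annihilated by `ℓ̄ = ⟨d_K², ·⟩` with `d_K = (1, δ, -1-δ)`. -/
theorem kcVec_in_ker {R : Type*} [CommRing R] (δ : R) :
    (1:R)^2 * kcVec₀ δ + δ^2 * kcVec₁ δ + (-1-δ)^2 * kcVec₂ δ = 0 := by
  unfold kcVec₀ kcVec₁ kcVec₂; ring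

/-- KERNEL CHANNEL identity: `Q(kcVec δ) = Σ dᵢ vᵢ² = 3 δ (δ+1) (δ²+δ+1)` for `d_K = (1, δ, -1-δ)`. -/
theorem Q_kcVec {R : Type*} [CommRing R] (δ : R) :
    (1:R) * (kcVec₀ δ)^2 + δ * (kcVec₁ δ)^2 + (-1-δ) * (kcVec₂ δ)^2
      = 3 * δ * (δ + 1) * (δ^2 + δ + 1) := by
  unfold kcVec₀ kcVec₁ kcVec₂; ring

/-- The kernel vector is never zero: its first component is `-2δ-1`, its last `1-δ²`; if both
vanished then `4δ² = 1` and `δ² = 1` would force `3 = 0`.  Stated over a field with `3 ≠ 0`. -/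
theorem kcVec_ne_zero {F : Type*} [Field F] (h3 : (3:F) ≠ 0) (δ : F) :
    kcVec₀ δ ≠ 0 ∨ kcVec₂ δ ≠ 0 := by
  by_cases h0 : kcVec₀ δ = 0
  · refine Or.inr ?_
    intro h2
    apply h3
    unfold kcVec₀ at h0; unfold kcVec₂ at h2
    have e1 : (2*δ + 1) = 0 := by linear_combination (-1:F) * h0
    have e2 : δ^2 = 1 := by linear_combination (-1:F) * h2
    -- 3 = (2δ+1)² - 4(δ² - 1) - 2(2δ+1)
    have e3 : (2*δ + 1)^2 = 0 := by rw [e1]; ring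
    linear_combination e3 - 4 * e2 - 2 * e1
  · exact Or.inl h0

/-- Over a field with `3 ≠ 0`: `Q` vanishes on the kernel line of `ℓ̄` exactly when `δ ∈ {0, -1}`
(then `d_K ∝ (1,0,-1)` up to `S₃`, where `ℓ̄|_V` is injective) or `δ² + δ + 1 = 0`
(the AS-degenerate eigenlines). -/
theorem Q_kcVec_eq_zero_iff {F : Type*} [Field F] (h3 : (3:F) ≠ 0) (δ : F) :
    (1:F) * (kcVec₀ δ)^2 + δ * (kcVec₁ δ)^2 + (-1-δ) * (kcVec₂ δ)^2 = 0
      ↔ δ = 0 ∨ δ = -1 ∨ δ^2 + δ + 1 = 0 := by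
  rw [Q_kcVec]
  constructor
  · intro h
    have : 3 * δ * (δ + 1) * (δ^2 + δ + 1) = 0 := h
    rcases mul_eq_zero.mp this with h1 | h1
    · rcases mul_eq_zero.mp h1 with h2 | h2
      · rcases mul_eq_zero.mp h2 with h4 | h4
        · exact absurd h4 h3
        · exact Or.inl h4
      · exact Or.inr (Or.inl (by linear_combination h2))
    · exact Or.inr (Or.inr h1)
  · rintro (h | h | h)
    · rw [h]; ring
    · rw [h]; ring
    · rw [h]; ring

/-- The norm form `d₁² + d₁d₂ + d₂²` has no nontrivial zero over `𝔽₅`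
(no `𝔽₅`-rational AS-degenerate K-digit; the cube roots of unity live in `𝔽₂₅`). -/
theorem normK_ne_zero_zmod5 :
    ∀ x y : ZMod 5, x^2 + x*y + y^2 = 0 → x = 0 ∧ y = 0 := by
  decide

/-- Over `𝔽₅` the factor `δ² + δ + 1` never vanishes, so `Q(kcVec δ) = 0 ↔ δ ∈ {0, -1}`. -/
theorem Q_kcVec_eq_zero_iff_zmod5 (δ : ZMod 5) :
    (1 : ZMod 5) * (kcVec₀ δ)^2 + δ * (kcVec₁ δ)^2 + (-1-δ) * (kcVec₂ δ)^2 = 0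
      ↔ δ = 0 ∨ δ = -1 := by
  revert δ; unfold kcVec₀ kcVec₁ kcVec₂; decide

end Summit.HodgeConjecture.HodgeConjecture.Theorems
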